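import Literature.MathematicalPhysics.QuantumManyBody.OneBodyCurrentGain
import Literature.MathematicalPhysics.QuantumManyBody.PeriodicConfigFourier
import Literature.MathematicalPhysics.QuantumManyBody.PeriodicBoseGasRelabelling
import Mathlib.Analysis.InnerProductSpace.Calculus
import HarnessLib

/-!
# The periodic `N`-body energy in real form and its first variation at a minimiser

Topic `Literature/MathematicalPhysics/QuantumManyBody`; companion of `PeriodicBoseGas.lean`
(`PeriodicTrialState`, `periodicEnergy`, `periodicGroundStateEnergy` — the `ℝ≥0∞` quadratic form
`∫_{[0,L)^{3N}} |∇Ψ|² + (∑_{i<j} v^per(xᵢ-xⱼ))|Ψ|²` over the `C¹` Bose-symmetric periodic class and its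
infimum `E₀`), of `OneBodyCurrentGain.lean` (`kineticDensityReal`, `kineticDensity_eq_ofReal`) and
`PeriodicBoseGasRelabelling.lean` (`periodicGroundStateEnergy_mul_lintegral_le`, the variational
principle for unnormalised functions). For potentials whose periodic interaction is `ofReal` of a
continuous real `V ≥ 0` (e.g. finite `C²` finite-range profiles on boxes `L > 2R₀`,
`PeriodizedPotentialNearestImage.lean`) everything is finite and the form is a real Bochner integral:

* `lintegral_cellN_nnnorm_sq_eq_ofReal_integral`, `lintegral_cellN_form_eq_ofReal` — `∫⁻ = ofReal ∫` for the
  mass and for the form of a `C¹` function;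
* `toReal_periodicGroundStateEnergy_mul_le` — the **variational inequality in real form**
  `E₀ ∫|φ|² ≤ ∫ (|∇φ|² + V|φ|²)` for every `C¹`, periodic, Bose-symmetric `φ`;
* `kineticDensityReal_add_smul`, `norm_add_smul_sq`, `integral_eq_of_quadratic`,
  `eq_zero_of_forall_quadratic_nonneg` — the second-order expansion of the form along `Ψ + tη` and
  the elementary fact that `2bt + ct² ≥ 0 ∀t` forces `b = 0`;
* `PeriodicTrialState.firstVariation_eq` — **the first variation at an exact minimiser**: if
  `periodicEnergy v Ψ = E₀ < ∞` then for every `C¹`, periodic, Bose-symmetric `η`,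
  `∫ (∑_{i,a} ⟪∂_{i,a}Ψ, ∂_{i,a}η⟫_ℝ + V⟪Ψ, η⟫_ℝ) = E₀ ∫ ⟪Ψ, η⟫_ℝ` (the real part of the weak
  eigenvalue equation `⟨∇Ψ, ∇η⟩ + ⟨VΨ, η⟩ = E₀⟨Ψ, η⟩`; the imaginary part follows with `iη`).

`⟪z, w⟫_ℝ = Re(z̄ w)` is Mathlib's real inner product on `ℂ`; `𝐞[i, a]` (local notation) is the
unit vector `Pi.single i (EuclideanSpace.single a 1)` of `kineticDensity`. The pointwise
(strong) equation follows from this first variation by Green's formula and du Bois-Reymond on the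
torus (`PeriodicConfigLaplacian.lean`) in the files using both. Not here: existence or regularity
of minimisers.

## References
* [Fournais2020] S. Fournais, *Length scales for BEC in the dilute Bose gas* (2020), (1.1)–(1.2)
  (the periodic form and `E(N, L) = inf spec`).
* [LSSY2005] E. H. Lieb, R. Seiringer, J. P. Solovej, J. Yngvason, *The Mathematics of the Bose Gas and
  its Condensation* (2005), Ch. 2 (2.1) (the Hamiltonian; ground state energy as the bottom of the
  spectrum, Rayleigh–Ritz).
-/

noncomputable section

open MeasureTheory Filter Set
open scoped ENNReal NNReal Topology InnerProductSpace

namespace Literature.MathematicalPhysics.QuantumManyBody.BoseGas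

variable {N : ℕ} {L : ℝ}

/-- The coordinate unit vector `e_{i,a}` of `(ℝ³)^N` (particle `i`, axis `a`), local notation. -/
local notation3 "𝐞[" i ", " a "]" => (Pi.single i (EuclideanSpace.single a (1 : ℝ)) : Config _)

/-! ### The energy functional in real form and the variational inequality -/

section Energy

variable {v : ℝ → ℝ≥0∞} {V : Config N → ℝ} {φ : Config N → ℂ}

/-- `∫⁻_{cell} ‖φ‖₊² = ENNReal.ofReal (∫_{cell} ‖φ‖²)` for continuous `φ`. [folklore] -/
theorem lintegral_cellN_nnnorm_sq_eq_ofReal_integral (hφ : Continuous φ) (L : ℝ) :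
    ∫⁻ X in cellN N L, ((‖φ X‖₊ : ℝ≥0∞)) ^ 2 = ENNReal.ofReal (∫ X in cellN N L, ‖φ X‖ ^ 2) := by
  simp_rw [coe_nnnorm_sq_eq_ofReal]
  rw [← ofReal_integral_eq_lintegral_ofReal]
  · exact integrableOn_cellN (hφ.norm.pow 2) L
  · exact Eventually.of_forall fun X => sq_nonneg _

/-- **The quadratic form in real terms.** If the periodic interaction is `ofReal` of a continuous
non-negative real potential `V`, then for `φ ∈ C¹`
`∫⁻_{cell} (|∇φ|² + V|φ|²) = ENNReal.ofReal (∫_{cell} (|∇φ|² + V|φ|²))` (real Bochner integral of a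
continuous integrand on the bounded cell). [folklore] -/
theorem lintegral_cellN_form_eq_ofReal (hφ : ContDiff ℝ 1 φ) (hV : Continuous V) (hV0 : ∀ X, 0 ≤ V X)
    (hW : ∀ X : Config N, periodicInteraction v L X = ENNReal.ofReal (V X)) :
    ∫⁻ X in cellN N L, (kineticDensity φ X + periodicInteraction v L X * ((‖φ X‖₊ : ℝ≥0∞)) ^ 2) =
      ENNReal.ofReal (∫ X in cellN N L, (kineticDensityReal φ X + V X * ‖φ X‖ ^ 2)) := by
  have hpt : ∀ X, kineticDensity φ X + periodicInteraction v L X * ((‖φ X‖₊ : ℝ≥0∞)) ^ 2 =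
      ENNReal.ofReal (kineticDensityReal φ X + V X * ‖φ X‖ ^ 2) := fun X => by
    rw [kineticDensity_eq_ofReal, hW, coe_nnnorm_sq_eq_ofReal, ← ENNReal.ofReal_mul (hV0 X),
      ← ENNReal.ofReal_add (kineticDensityReal_nonneg _ _) (mul_nonneg (hV0 X) (sq_nonneg _))]
  simp_rw [hpt]
  rw [← ofReal_integral_eq_lintegral_ofReal]
  · exact integrableOn_cellN ((continuous_kineticDensityReal hφ).add
      (hV.mul (hφ.continuous.norm.pow 2))) L
  · exact Eventually.of_forall fun X =>
      add_nonneg (kineticDensityReal_nonneg _ _) (mul_nonneg (hV0 X) (sq_nonneg _))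

/-- **Variational inequality, real form.** For every `C¹`, `Lℤ³`-periodic, Bose-symmetric `φ` and a
finite ground-state energy `E₀ = periodicGroundStateEnergy v N L`:
`E₀ ∫_{cell} |φ|² ≤ ∫_{cell} (|∇φ|² + V|φ|²)` (normalise `φ`; `periodicGroundStateEnergy_mul_lintegral_le`).
[cite: LSSY2005, Ch. 2 (2.3)] -/
theorem toReal_periodicGroundStateEnergy_mul_le (hφ : ContDiff ℝ 1 φ) (hper : IsTorusPeriodic L φ)
    (hsymm : ∀ (σ : Equiv.Perm (Fin N)) (X : Config N), φ (X ∘ σ) = φ X)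
    (hV : Continuous V) (hV0 : ∀ X, 0 ≤ V X)
    (hW : ∀ X : Config N, periodicInteraction v L X = ENNReal.ofReal (V X))
    (hE : periodicGroundStateEnergy v N L ≠ ⊤) :
    (periodicGroundStateEnergy v N L).toReal * ∫ X in cellN N L, ‖φ X‖ ^ 2 ≤
      ∫ X in cellN N L, (kineticDensityReal φ X + V X * ‖φ X‖ ^ 2) := by
  have h := periodicGroundStateEnergy_mul_lintegral_le v hφ hper hsymm
    (by rw [lintegral_cellN_nnnorm_sq_eq_ofReal_integral hφ.continuous]; exact ENNReal.ofReal_ne_top)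
  rw [lintegral_cellN_nnnorm_sq_eq_ofReal_integral hφ.continuous, lintegral_cellN_form_eq_ofReal hφ hV hV0 hW,
    ← ENNReal.ofReal_toReal hE, ← ENNReal.ofReal_mul ENNReal.toReal_nonneg] at h
  exact (ENNReal.ofReal_le_ofReal_iff (integral_nonneg fun X =>
    add_nonneg (kineticDensityReal_nonneg _ _) (mul_nonneg (hV0 X) (sq_nonneg _)))).1 h

end Energy

/-! ### The first variation -/

section FirstVariation

variable {v : ℝ → ℝ≥0∞} {V : Config N → ℝ} {φ η : Config N → ℂ} {X : Config N}

/-- `D(φ + tη)(X) w = Dφ(X) w + t Dη(X) w` at points of differentiability. [folklore] -/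
theorem fderiv_add_smul_apply (hφ : DifferentiableAt ℝ φ X) (hη : DifferentiableAt ℝ η X) (t : ℝ)
    (w : Config N) : fderiv ℝ (φ + t • η) X w = fderiv ℝ φ X w + t • fderiv ℝ η X w := by
  rw [fderiv_add hφ (hη.const_smul t), fderiv_const_smul hη]
  rfl

/-- `‖x + t y‖² = ‖x‖² + 2t⟪x, y⟫ + t²‖y‖²` in a real inner product space. [folklore] -/
theorem norm_add_smul_sq {F : Type*} [NormedAddCommGroup F] [InnerProductSpace ℝ F] (x y : F)
    (t : ℝ) : ‖x + t • y‖ ^ 2 = ‖x‖ ^ 2 + 2 * t * ⟪x, y⟫_ℝ + t ^ 2 * ‖y‖ ^ 2 := by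
  rw [norm_add_sq_real, real_inner_smul_right, norm_smul, mul_pow, Real.norm_eq_abs, sq_abs]
  ring

/-- Polarisation of the kinetic density: `|∇(φ + tη)|² = |∇φ|² + 2t ∑ ⟪∂φ, ∂η⟫_ℝ + t²|∇η|²` at
points of differentiability. [folklore] -/
theorem kineticDensityReal_add_smul (hφ : DifferentiableAt ℝ φ X) (hη : DifferentiableAt ℝ η X)
    (t : ℝ) :
    kineticDensityReal (φ + t • η) X = kineticDensityReal φ X +
      2 * t * (∑ i : Fin N, ∑ a : Fin 3, ⟪fderiv ℝ φ X 𝐞[i, a], fderiv ℝ η X 𝐞[i, a]⟫_ℝ) +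
      t ^ 2 * kineticDensityReal η X := by
  unfold kineticDensityReal
  simp_rw [fderiv_add_smul_apply hφ hη, norm_add_smul_sq]
  simp only [Finset.sum_add_distrib, ← Finset.mul_sum]

/-- Linearity of the integral against a quadratic expansion in `t`. [folklore] -/
theorem integral_eq_of_quadratic {α : Type*} [MeasurableSpace α] {μ : Measure α}
    {f g₀ g₁ g₂ : α → ℝ} (t : ℝ) (h : ∀ x, f x = g₀ x + 2 * t * g₁ x + t ^ 2 * g₂ x)
    (h₀ : Integrable g₀ μ) (h₁ : Integrable g₁ μ) (h₂ : Integrable g₂ μ) :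
    ∫ x, f x ∂μ = (∫ x, g₀ x ∂μ) + 2 * t * (∫ x, g₁ x ∂μ) + t ^ 2 * ∫ x, g₂ x ∂μ := by
  simp_rw [h]
  have i01 : Integrable (fun x => g₀ x + 2 * t * g₁ x) μ := h₀.add (h₁.const_mul _)
  have i1 : Integrable (fun x => 2 * t * g₁ x) μ := h₁.const_mul _
  have i2 : Integrable (fun x => t ^ 2 * g₂ x) μ := h₂.const_mul _
  rw [integral_add i01 i2, integral_add h₀ i1, integral_const_mul, integral_const_mul]

/-- A real quadratic `2bt + ct²` that is non-negative for all real `t` has `b = 0`. [folklore] -/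
theorem eq_zero_of_forall_quadratic_nonneg {b c : ℝ} (hc : 0 ≤ c)
    (h : ∀ t : ℝ, 0 ≤ 2 * t * b + t ^ 2 * c) : b = 0 := by
  by_contra hb
  have hpos : 0 < c + 1 := by linarith
  have key := h (-b / (c + 1))
  have hval : 2 * (-b / (c + 1)) * b + (-b / (c + 1)) ^ 2 * c = -(b ^ 2 * (c + 2)) / (c + 1) ^ 2 := by
    field_simp
    ring
  rw [hval] at key
  have hb2 : 0 < b ^ 2 := by positivity
  have hnum : 0 < b ^ 2 * (c + 2) := by positivity
  have : -(b ^ 2 * (c + 2)) / (c + 1) ^ 2 < 0 := div_neg_of_neg_of_pos (by linarith) (by positivity)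
  linarith

/-- **First variation of the periodic energy at a minimiser.** Let the periodic interaction be
`ofReal` of a continuous real potential `V ≥ 0`, let `Ψ` be an exact minimiser
(`periodicEnergy v Ψ = E₀ < ∞`) and `η` a `C¹`, `Lℤ³`-periodic, Bose-symmetric test function. Then
`∫_{cell} (∑_{i,a} ⟪∂_{i,a}Ψ, ∂_{i,a}η⟫_ℝ + V⟪Ψ, η⟫_ℝ) = E₀ ∫_{cell} ⟪Ψ, η⟫_ℝ`
(expand the variational inequality for `Ψ + tη`, `t ∈ ℝ`, to second order in `t`).
[cite: ReedSimonIV1978, §XIII.1 (min–max / Rayleigh quotient)] -/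
theorem PeriodicTrialState.firstVariation_eq (hV : Continuous V) (hV0 : ∀ X, 0 ≤ V X)
    (hW : ∀ X : Config N, periodicInteraction v L X = ENNReal.ofReal (V X))
    (Ψ : PeriodicTrialState N L) (hmin : periodicEnergy v Ψ = periodicGroundStateEnergy v N L)
    (hfin : periodicEnergy v Ψ ≠ ⊤) (hη : ContDiff ℝ 1 η) (hηp : IsTorusPeriodic L η)
    (hηs : ∀ (σ : Equiv.Perm (Fin N)) (X : Config N), η (X ∘ σ) = η X) :
    ∫ X in cellN N L, (∑ i : Fin N, ∑ a : Fin 3,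
        ⟪fderiv ℝ Ψ.ψ X 𝐞[i, a], fderiv ℝ η X 𝐞[i, a]⟫_ℝ + V X * ⟪Ψ.ψ X, η X⟫_ℝ) =
      (periodicGroundStateEnergy v N L).toReal * ∫ X in cellN N L, ⟪Ψ.ψ X, η X⟫_ℝ := by
  set ψ := Ψ.ψ with hψdef
  set E : ℝ := (periodicGroundStateEnergy v N L).toReal with hEdef
  have hEtop : periodicGroundStateEnergy v N L ≠ ⊤ := hmin ▸ hfin
  have hψ : ContDiff ℝ 1 ψ := Ψ.contDiff
  -- the functionals `F φ = ∫ (|∇φ|² + V|φ|²)` and `M φ = ∫ |φ|²`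
  have hq : ∀ φ : Config N → ℂ, ContDiff ℝ 1 φ → IsTorusPeriodic L φ →
      (∀ (σ : Equiv.Perm (Fin N)) (X : Config N), φ (X ∘ σ) = φ X) →
      E * (∫ X in cellN N L, ‖φ X‖ ^ 2) ≤
        ∫ X in cellN N L, (kineticDensityReal φ X + V X * ‖φ X‖ ^ 2) := fun φ h1 h2 h3 =>
    toReal_periodicGroundStateEnergy_mul_le h1 h2 h3 hV hV0 hW hEtop
  have hFψ : ∫ X in cellN N L, (kineticDensityReal ψ X + V X * ‖ψ X‖ ^ 2) = E := by
    have h := lintegral_cellN_form_eq_ofReal (L := L) hψ hV hV0 hW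
    change periodicEnergy v Ψ = _ at h
    rw [hmin] at h
    rw [hEdef, h, ENNReal.toReal_ofReal (integral_nonneg fun X =>
      add_nonneg (kineticDensityReal_nonneg _ _) (mul_nonneg (hV0 X) (sq_nonneg _)))]
  have hMψ : ∫ X in cellN N L, ‖ψ X‖ ^ 2 = 1 := by
    have h := Ψ.norm_eq
    rw [lintegral_cellN_nnnorm_sq_eq_ofReal_integral Ψ.contDiff.continuous, ENNReal.ofReal_eq_one] at h
    exact h
  -- integrability of all continuous integrands on the cell
  have hdc : ∀ {φ : Config N → ℂ}, ContDiff ℝ 1 φ → ∀ (i : Fin N) (a : Fin 3),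
      Continuous fun X => fderiv ℝ φ X 𝐞[i, a] := fun h i a =>
    (h.continuous_fderiv one_ne_zero).clm_apply continuous_const
  have hcB : Continuous fun X => ∑ i : Fin N, ∑ a : Fin 3,
      ⟪fderiv ℝ ψ X 𝐞[i, a], fderiv ℝ η X 𝐞[i, a]⟫_ℝ + V X * ⟪ψ X, η X⟫_ℝ :=
    (continuous_finsetSum _ fun i _ => continuous_finsetSum _ fun a _ =>
      (hdc hψ i a).inner (𝕜 := ℝ) (hdc hη i a)).add (hV.mul (hψ.continuous.inner (𝕜 := ℝ) hη.continuous))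
  have hcF : ∀ {φ : Config N → ℂ}, ContDiff ℝ 1 φ →
      Continuous fun X => kineticDensityReal φ X + V X * ‖φ X‖ ^ 2 := fun h =>
    (continuous_kineticDensityReal h).add (hV.mul (h.continuous.norm.pow 2))
  -- the expansions in `t`
  set B : ℝ := ∫ X in cellN N L, (∑ i : Fin N, ∑ a : Fin 3,
      ⟪fderiv ℝ ψ X 𝐞[i, a], fderiv ℝ η X 𝐞[i, a]⟫_ℝ + V X * ⟪ψ X, η X⟫_ℝ) with hBdef
  set P : ℝ := ∫ X in cellN N L, ⟪ψ X, η X⟫_ℝ with hPdef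
  have hψd : ∀ X, DifferentiableAt ℝ ψ X := fun X => hψ.differentiable one_ne_zero X
  have hηd : ∀ X, DifferentiableAt ℝ η X := fun X => hη.differentiable one_ne_zero X
  have hF : ∀ t : ℝ, ∫ X in cellN N L, (kineticDensityReal (ψ + t • η) X + V X * ‖(ψ + t • η) X‖ ^ 2) =
      (∫ X in cellN N L, (kineticDensityReal ψ X + V X * ‖ψ X‖ ^ 2)) + 2 * t * B +
        t ^ 2 * ∫ X in cellN N L, (kineticDensityReal η X + V X * ‖η X‖ ^ 2) := by
    intro t
    refine integral_eq_of_quadratic t (fun X => ?_) (integrableOn_cellN (hcF hψ) L)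
      (integrableOn_cellN hcB L) (integrableOn_cellN (hcF hη) L)
    rw [kineticDensityReal_add_smul (hψd X) (hηd X), Pi.add_apply, Pi.smul_apply, norm_add_smul_sq]
    ring
  have hM : ∀ t : ℝ, ∫ X in cellN N L, ‖(ψ + t • η) X‖ ^ 2 =
      (∫ X in cellN N L, ‖ψ X‖ ^ 2) + 2 * t * P + t ^ 2 * ∫ X in cellN N L, ‖η X‖ ^ 2 := by
    intro t
    refine integral_eq_of_quadratic t (fun X => ?_) (integrableOn_cellN (hψ.continuous.norm.pow 2) L)
      (integrableOn_cellN (hψ.continuous.inner (𝕜 := ℝ) hη.continuous) L)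
      (integrableOn_cellN (hη.continuous.norm.pow 2) L)
    rw [Pi.add_apply, Pi.smul_apply, norm_add_smul_sq]
  -- the variational inequality along the line `Ψ + tη`
  have hineq : ∀ t : ℝ, 0 ≤ 2 * t * (B - E * P) +
      t ^ 2 * ((∫ X in cellN N L, (kineticDensityReal η X + V X * ‖η X‖ ^ 2)) -
        E * ∫ X in cellN N L, ‖η X‖ ^ 2) := by
    intro t
    have h1 : ContDiff ℝ 1 (ψ + t • η) := hψ.add (contDiff_const.smul hη)
    have h2 : IsTorusPeriodic L (ψ + t • η) := fun X i k => by
      simp only [Pi.add_apply, Pi.smul_apply, Ψ.periodic X i k, hηp X i k, hψdef]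
    have h3 : ∀ (σ : Equiv.Perm (Fin N)) (X : Config N), (ψ + t • η) (X ∘ σ) = (ψ + t • η) X :=
      fun σ X => by simp only [Pi.add_apply, Pi.smul_apply, Ψ.symm σ X, hηs σ X, hψdef]
    have h := hq _ h1 h2 h3
    rw [hF, hM, hFψ, hMψ] at h
    nlinarith [h]
  have hc : 0 ≤ (∫ X in cellN N L, (kineticDensityReal η X + V X * ‖η X‖ ^ 2)) -
      E * ∫ X in cellN N L, ‖η X‖ ^ 2 := by linarith [hq η hη hηp hηs]
  have hb := eq_zero_of_forall_quadratic_nonneg hc hineq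
  linarith

end FirstVariation

end Literature.MathematicalPhysics.QuantumManyBody.BoseGas

end
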